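import Summits.CriticalPhenomena.PercolationContinuityZ3.Theorems.Transplant.TriFilmSKPlan
import HarnessLib

/-!
# Triangular film `𝕋 × {0,1}`, VII: from kernel certificates to the NODE CLAUSE of `ShapedLinkage 3` for one case

builds on p205010 (kernel theorem, internal audit signed; external expert review pending) — NOT used in this file.  Lane `prim-bschramm`, seat
`prim-bschramm-p2` (gen 39; class C1b; memo `HOME/bschramm/P2-LATTICES.md` §138); helper file (`--supports stmt-CriticalPhenomena-4575 --as helper`).
«Slab111SK4Case» for the triangular films:
* §1 `RowOK` / **`CaseOK C`** (every needed bit of every certified pair has a covering plan) and the soundness of the certificate readers of «TriFilmSKDefs»: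
  `rdPlans_sound`, `checkRow_sound`, **`checkEs_sound`**, `caseOK_of_chunks`;
* §2 the admissibility masks `allowedM`/`forcedM` of the cleared mask;
* §3 **`linkage_of_caseOK`** — the clause of `ShapedLinkage 3 (TriFilm.hexShadow k)` at every block `z` and all node parameters the case dominates, with the
  cleared set `WsetT C z` («TriFilmSKPath»): terminals pass the filter («TriFilmSKTerms»), cover bits are swap pairs («TriFilmSKPlan»).
[cite: DuminilCopinSidoraviciusTassion2016, §2.3 (proof of Fact 2: the three disjoint paths in B_R(z))]
-/

noncomputable section

namespace Summit.CriticalPhenomena.PercolationContinuityZ3.Theorems.Transplant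

open Literature.Probability.Percolation Literature.Probability.LatticeModels SimpleGraph
open scoped Classical

namespace TriFilm.SKT

open Slab111.SK (bitOf sdiff maskBelow maskOfList endsOK orFold rd rdMask testBit_bitOf testBit_sdiff testBit_maskBelow of_testBit_maskBelow testBit_maskBelow_of testBit_of_sdiff_beq)
open Slab111.SK4 (dL4 dA4 dB4)

variable {C : CtxT} {z : Site 2}

/-! ## §1 Case coverage and the certificate readers -/

/-- **Row coverage**: every needed bit of every partner of `e₁` has a covering plan. [folklore] -/
def RowOK (C : CtxT) (e1 : ℕ) : Prop :=
  ∀ e2 ∈ C.esList, e2 ≠ e1 → ∀ w, (C.needMask e1 e2).testBit w = true → ∃ c1 y b c2 av, (C.coverOf e1 e2 c1 y b c2 av).testBit w = true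

/-- **Case coverage**: all rows. [folklore] -/
def CaseOK (C : CtxT) : Prop := ∀ e1 ∈ C.esList, RowOK C e1

/-- Soundness of the plan reader: an accumulated bit comes from the accumulator or from one of the plans read. [folklore] -/
theorem rdPlans_sound (C : CtxT) (e1 e2 w : ℕ) : ∀ (cnt n acc : ℕ), (C.rdPlans e1 e2 cnt n acc).1.testBit w = true →
    acc.testBit w = true ∨ ∃ c1 y b c2 av, (C.coverOf e1 e2 c1 y b c2 av).testBit w = true
  | 0, _, _, h => Or.inl h
  | cnt + 1, n, acc, h => by
    simp only [CtxT.rdPlans] at h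
    rcases rdPlans_sound C e1 e2 w cnt _ _ h with h | h
    · revert h
      cases (C.coverOf e1 e2 (rd n).1 (rd (rd n).2).1 (rd (rd (rd n).2).2).1 (rd (rd (rd (rd n).2).2).2).1
          (rdMask (rd (rd (rd (rd (rd n).2).2).2).2).1 (rd (rd (rd (rd (rd n).2).2).2).2).2 0).1 == 0) with
      | true => intro h; exact Or.inl h
      | false =>
        intro h
        simp only [cond_false, Nat.testBit_lor, Bool.or_eq_true] at h
        rcases h with h | h
        · exact Or.inl h
        · exact Or.inr ⟨_, _, _, _, _, h⟩
    · exact Or.inr h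

/-- **Soundness of the row checker.** [folklore] -/
theorem checkRow_sound (C : CtxT) (e1 : ℕ) : ∀ (es : List ℕ) (n : ℕ), C.checkRow e1 es n = true →
    ∀ e2 ∈ es, e2 ≠ e1 → ∀ w, (C.needMask e1 e2).testBit w = true → ∃ c1 y b c2 av, (C.coverOf e1 e2 c1 y b c2 av).testBit w = true
  | [], _, _ => fun _ h => nomatch h
  | e2 :: rest, n, h => by
    intro x hx hxe w hw
    simp only [CtxT.checkRow] at h
    by_cases he : e2 = e1
    · have hb : (e2 == e1) = true := by simp [he]
      rw [hb, cond_true] at h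
      rcases List.mem_cons.1 hx with rfl | hx
      · exact absurd he hxe
      · exact checkRow_sound C e1 rest n h x hx hxe w hw
    · have hb : (e2 == e1) = false := by simp [he]
      rw [hb, cond_false] at h
      by_cases hn : C.needMask e1 e2 = 0
      · have hb2 : (C.needMask e1 e2 == 0) = true := by simp [hn]
        rw [hb2, cond_true] at h
        rcases List.mem_cons.1 hx with rfl | hx
        · rw [hn, Nat.zero_testBit] at hw; exact absurd hw Bool.false_ne_true
        · exact checkRow_sound C e1 rest n h x hx hxe w hw
      · have hb2 : (C.needMask e1 e2 == 0) = false := by simp [hn]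
        rw [hb2, cond_false] at h
        try dsimp only at h
        generalize hr : C.rdPlans e1 e2 (rd n).1 (rd n).2 0 = r at h
        cases hs : (sdiff (C.needMask e1 e2) r.1 == 0) with
        | false => rw [hs] at h; exact absurd h Bool.false_ne_true
        | true =>
          rw [hs, cond_true] at h
          rcases List.mem_cons.1 hx with rfl | hx
          · have hcov := testBit_of_sdiff_beq hs hw
            rw [← hr] at hcov
            rcases rdPlans_sound C e1 _ w _ _ _ hcov with h0 | hp
            · rw [Nat.zero_testBit] at h0; exact absurd h0 Bool.false_ne_true
            · exact hp
          · exact checkRow_sound C e1 rest _ h x hx hxe w hw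

/-- **SOUNDNESS OF A KERNEL-CHECKED CHUNK**: `C.checkEs es certs = true` gives row coverage for every terminal of the chunk. [folklore] -/
theorem checkEs_sound (C : CtxT) : ∀ (es certs : List ℕ), C.checkEs es certs = true → ∀ e1 ∈ es, RowOK C e1
  | [], _, _ => fun _ h => nomatch h
  | e1 :: rest, certs, h => by
    intro x hx
    cases certs with
    | nil => simp [CtxT.checkEs] at h
    | cons n certs' =>
      simp only [CtxT.checkEs] at h
      cases hrow : C.checkRow e1 C.esList n with
      | false => rw [hrow] at h; exact absurd h Bool.false_ne_true
      | true =>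
        rw [hrow, cond_true] at h
        rcases List.mem_cons.1 hx with rfl | hx
        · exact fun e2 he2 hne w hw => checkRow_sound C x C.esList n hrow e2 he2 hne w hw
        · exact checkEs_sound C rest certs' h x hx

/-- **Case coverage from chunks covering the terminal list.** [folklore] -/
theorem caseOK_of_chunks (C : CtxT) (chunks : List (List ℕ)) (h : ∀ ch ∈ chunks, ∀ e1 ∈ ch, RowOK C e1)
    (hcov : (C.esList.all fun e => chunks.any fun ch => ch.elem e) = true) : CaseOK C := by
  intro e1 he1
  rw [List.all_eq_true] at hcov
  have := hcov e1 he1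
  rw [List.any_eq_true] at this
  obtain ⟨ch, hch, hel⟩ := this
  exact h ch hch e1 (List.elem_iff.1 hel)

/-! ## §2 Admissibility masks of the cleared mask -/

/-- Allowed bits: over `hexBall z 3 ∩ {a ≤ t₁} ∩ {a + b ≤ s₁}`. [folklore] -/
def CtxT.allowedB (C : CtxT) (t1 s1 i : ℕ) : Bool :=
  C.validB i && decide (3 ≤ dA4 i) && decide (dA4 i ≤ 9) && decide (3 ≤ dB4 i) && decide (dB4 i ≤ 9) && decide (9 ≤ dA4 i + dB4 i) &&
    decide (dA4 i + dB4 i ≤ 15) && decide (dA4 i ≤ t1 + 6) && decide (dA4 i + dB4 i ≤ s1 + 12)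

/-- Forced bits: over `hexBall z 1 ∩ {a ≤ t₁} ∩ {a + b ≤ s₁}`. [folklore] -/
def CtxT.forcedB (C : CtxT) (t1 s1 i : ℕ) : Bool :=
  C.validB i && decide (5 ≤ dA4 i) && decide (dA4 i ≤ 7) && decide (5 ≤ dB4 i) && decide (dB4 i ≤ 7) && decide (11 ≤ dA4 i + dB4 i) &&
    decide (dA4 i + dB4 i ≤ 13) && decide (dA4 i ≤ t1 + 6) && decide (dA4 i + dB4 i ≤ s1 + 12)

/-- The allowed mask. [folklore] -/
def CtxT.allowedM (C : CtxT) (t1 s1 : ℕ) : ℕ := maskBelow (C.allowedB t1 s1) 1440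
/-- The forced mask. [folklore] -/
def CtxT.forcedM (C : CtxT) (t1 s1 : ℕ) : ℕ := maskBelow (C.forcedB t1 s1) 1440

/-! ## §3 The node clause for a covered case -/

/-- **THE NODE CLAUSE OF `ShapedLinkage 3 (TriFilm.hexShadow k)` FOR ONE COVERED CASE.**  For a case context `C` with `CaseOK C` and an admissible cleared
mask (`C.wOK (allowedM t₁ s₁) (forcedM t₁ s₁)`, `t₁ ≤ t_D`, `s₁ ≤ s_D`, each either exact or `≥ 1`), every block centre `z` and all node parameters the case
dominates (`C.tR = min t_R 3`, `C.sR = min s_R 3`, window bounds at least `t_D`, `s_R` or unconstrained): the cleared set `WsetT C z` lies in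
`\overline{blkR 3 z t_D s_D}`, contains every vertex over `hexBall z 1 ∩ blkR 3 z t_D s_D`, and every certified terminal triple has a swap pair of routings.
[cite: DuminilCopinSidoraviciusTassion2016, §2.3 (proof of Fact 2: the three disjoint paths in B_R(z))] -/
theorem linkage_of_caseOK (hcase : CaseOK C) (hk : C.k ≤ 9) (z : Site 2) {tR tD sR sD : ℕ}
    (htR : C.tR = min tR 3) (hsR : C.sR = min sR 3) (hwT : tD ≤ C.wT ∨ 4 ≤ C.wT) (hwS : sR ≤ C.wS ∨ 4 ≤ C.wS)
    {t1 s1 : ℕ} (ht1 : t1 ≤ tD) (hs1 : s1 ≤ sD) (ht1' : t1 = tD ∨ 1 ≤ t1) (hs1' : s1 = sD ∨ 1 ≤ s1)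
    (hW : C.wOK (C.allowedM t1 s1) (C.forcedM t1 s1) = true) :
    (∀ x ∈ WsetT C z, (hexShadow C.k).sh x ∈ blkR 3 z tD sD) ∧
      (∀ x, (hexShadow C.k).sh x ∈ hexBall z 1 → (hexShadow C.k).sh x ∈ blkR 3 z tD sD → x ∈ WsetT C z) ∧
        ∀ (E₁ E₂ w' : triFilm C.k), (hexShadow C.k).Terminals 3 z tR tD sR (WsetT C z) E₁ E₂ w' →
          ∃ r₁ r₂ : VRouteData (film C.k) (WsetT C z ∩ (hexShadow C.k).lift (blkR 3 z tR sR)) (WsetT C z) E₁ E₂ w', r₁.y = r₂.b ∧ r₁.b = r₂.y := by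
  have hW' := hW
  simp only [CtxT.wOK, Bool.and_eq_true] at hW'
  obtain ⟨hWall, hWfor⟩ := hW'
  have hWv : ∀ i, C.W.testBit i = true → C.validB i = true := by
    intro i hi
    have := of_testBit_maskBelow (testBit_of_sdiff_beq hWall hi)
    simp only [CtxT.allowedB, Bool.and_eq_true] at this
    exact this.2.1.1.1.1.1.1.1.1
  refine ⟨fun x hx => ?_, fun x h1 hD => ?_, fun E₁ E₂ w' hT => ?_⟩
  · obtain ⟨i, hv, hWi, rfl⟩ := exists_idx_of_mem_Wset hx
    have := of_testBit_maskBelow (testBit_of_sdiff_beq hWall hWi)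
    simp only [CtxT.allowedB, Bool.and_eq_true, decide_eq_true_eq] at this
    obtain ⟨⟨⟨⟨⟨⟨⟨⟨-, h1⟩, h2⟩, h3⟩, h4⟩, h5⟩, h6⟩, h7⟩, h8⟩ := this.2
    exact mem_blkR_of_digits i ht1 hs1 ⟨h1, h2, h3, h4, h5, h6, h7, h8⟩
  · obtain ⟨i, hv, rfl⟩ := exists_idx hk x (by rw [mem_hexBall] at h1; exact h1.trans (by norm_num))
    obtain ⟨h1, h2, h3, h4, h5, h6, h7, h8⟩ := digits_of_mem_hexBall_one i h1 hD
    have hf : C.forcedB t1 s1 i = true := by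
      simp only [CtxT.forcedB, hv, Bool.true_and, Bool.and_eq_true, decide_eq_true_eq]
      refine ⟨⟨⟨⟨⟨⟨⟨h1, h2⟩, h3⟩, h4⟩, h5⟩, h6⟩, ?_⟩, ?_⟩
      · rcases ht1' with rfl | h; exact h7; omega
      · rcases hs1' with rfl | h; exact h8; omega
    exact (vtx_mem_Wset_iff hv).2 (testBit_of_sdiff_beq hWfor (testBit_maskBelow_of ((validB_iff C i).1 hv).1 hf))
  · obtain ⟨e1, e2, w, hv1, hv2, hvw, rfl, rfl, rfl, -, -, -, he1, he2, hne, hneed⟩ := terminals_sound hk htR hsR hwT hwS hT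
    obtain ⟨c1, y, b, c2, av, hcov⟩ := hcase e1 he1 e2 he2 (Ne.symm hne) w hneed
    exact coverOf_sound htR hsR hWv hcov

end TriFilm.SKT

end Summit.CriticalPhenomena.PercolationContinuityZ3.Theorems.Transplant

end
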